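import Summits.BirchSwinnertonDyer.Rank1Residual.Additive.DefectCountSignedTwistAssembly
import Summits.BirchSwinnertonDyer.Rank1Residual.Additive.DefectCountLevelInputs
import Summits.BirchSwinnertonDyer.Rank1Residual.Additive.StrictSignedLocalPreimageCard
import Summits.BirchSwinnertonDyer.Rank1Residual.Additive.TowerStructureLocalIndex
import Summits.BirchSwinnertonDyer.Rank1Residual.Additive.StrictSelmerIndex
import Summits.BirchSwinnertonDyer.Rank1Residual.Additive.QuadraticTwistStrictSelmerExactControl
import Literature.NumberTheory.EllipticCurves.BSDConductorProofs
import HarnessLib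

/-!
# THE SELMER SIDE OF THE (C3_η) DERIVATION FOR THE `p*`-TWIST, COMPOSED AND LEVEL-FREE IN RANK ONE:
# **`#Ш(W)[p^∞] · p^{2ν} · ∏_{ℓ ∈ T} p^{ord_p c_ℓ(W)} = p^{ord_p f(0)}`**
# (cell `b2b-bsdres`, CLASS-CLOSURE lane, class O10 — x1b GEN 42, class lead; file 108 of the series)

HONEST FRAMING (cell `b2b-bsdres`, run/shared/lean/b2b/bsd-rank1-residual/, verbatim in every
file): the goal of the cell is to DELETE the COMBINATION-SHAPED residual classes of the
Birch–Swinnerton-Dyer formula for ALL analytic-rank `≤ 1` elliptic curves over `ℚ` — "full BSD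
formula for every rank `≤ 1` curve in class `C`" assembled STRICTLY from published theorems — so
that the rank-`≤ 1` remainder becomes exactly the CONSTRUCTION-SHAPED classes, which are TYPED
(missing-input `Prop`s), NOT attempted. This is not "finishing BSD". CLASS-CLOSURE lane: prove
what is provable now; shrink each hard class to its core with data; no claim beyond stated classes;
research routes on CONSTRUCTION-SHAPED X12 / O10; census / instrument output = EVIDENCE / conjecture
items, NEVER a Literature fact; `RESIDUAL-MAP.md` marks change only by signed lines. THIS FILE:
TOOL THEOREMS ONLY — no definition, no named Literature fact, no Summits-side fact `def … : Prop`,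
no `sorry`, axioms standard; CONDITIONAL (hypothesis `hPT`) on the NAMED FACT
`poitouTate_selmerStructure_duality_real ℚ` (Milne *ADT* I Thm. 4.10 with the real place), on the
strict signed DUAL DATUM `D` of `Sel^{−,str}(W/ℚ_∞)` with its `Λ`-structure (f.g. torsion, no finite
submodule, `char = (f)`, `f(0) ≠ 0` — where (C1_η) plugs in), and on the RANK-ONE INPUTS of the pair
in the currency of the typed (C3_η): a point `P ∈ W(ℚ)` of infinite order generating `W(ℚ)` modulo
torsion and its exact local level `ν` in `W(ℚ_p)` (Gross–Zagier–Kolyvagin for the pair — NOT proved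
here). Nothing is booked; no label / mark / count / sub-cell moves; (C1_η), (C2_η-GZ), (C3_η) stay
typed as filed (cc-typer-6's pen); O10 stays OPEN / CONSTRUCTION-SHAPED; nothing about `BSD(W, p)`
of any pair is claimed.

## What

`W` is the `(−1)^{p/2}p`-twist of a globally minimal `V/ℚ` good at the odd prime `p` with
`a_p(V) = 0`, `W`'s equation `p`-integral, `κ` the cyclotomic `ℤ_p`-extension.

* §1 (level `p^m`) `card_strictSelmerPInfty_mul_eq_pow_of_quadraticTwist_signedPrime`:
  **`#Sel_str(W/ℚ)[p^∞] · (p^ν · ∏_{ℓ ∈ T} p^{ord_p c_ℓ(W)}) = p^{ord_p f(0)}`** — file 59 (`#A₀ =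
  #S₀·[A₀:S₀] = p^{ord_p f(0)}`, discharging `#A₀ ∣ p^a`), file 107 (the count (C):
  `[A₀ : S₀] = p^ν·∏[𝓣_ℓ : 𝓚_ℓ]`, the tower structure supplied as an explicit term), file 75
  (`[𝓣_ℓ : 𝓚_ℓ] = p^{ord_p c_ℓ}`; no finite place splits in the cyclotomic tower — file 54) and
  `#S₀ = #Sel_str` composed; level-`m` hypotheses ((MW), (Ш), exact level at `ℚ_{v₀}`, (kill),
  `ord_p c_ℓ ≤ m`, `𝒦_{v,0}[p^∞] = 0` off `T ∪ {v₀}`, numerology) remain.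
* §2 (rank one, LEVEL-FREE; the level `m = ord_p f(0) + 2ν + e + ∑ s_ℓ + ∑ ord_p c_ℓ + 1` chosen
  inside, every level-`m` input supplied by file 109 — (kill) AEC VII.6.3, (MW) from the generator
  with `W(ℚ)[p] = 0` from file 55, (Ш) exponent, (loc) along `ℚ_[p] ≃ ℚ_{v₀}`, B4 cyclotomic):
  `finite_primaryComponent_sha_of_quadraticTwist_signedPrime` — **`Ш(W)[p^∞]` is FINITE** (file 57:
  `Sel_str` finite; gen 30: `#Sel_str = p^ν · #Ш[p^∞]`);
  `card_strictSelmerPInfty_mul_eq_pow_of_quadraticTwist_signedPrime_rankOne` —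
  **`#Sel_str(W/ℚ)[p^∞] · (p^ν · ∏_{ℓ ∈ T} p^{ord_p c_ℓ}) = p^{ord_p f(0)}`** for ANY finite `T ∌ (p)`
  containing every `ℓ ≠ p` with `p ∣ c_ℓ(W)`; `card_sha_mul_eq_pow_of_quadraticTwist_signedPrime_rankOne`
  — **`#Ш(W)[p^∞] · (p^{2ν} · ∏_{ℓ ∈ T} p^{ord_p c_ℓ}) = p^{ord_p f(0)}`**, the ALGEBRAIC SIDE of
  `BSD_p(W)` through `f(0)`; and `…_of_not_dvd` — **`#Ш(W)[p^∞] · p^{2ν} = p^{ord_p f(0)}`** when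
  `p ∤ c_ℓ(W)` for all `ℓ ≠ p` (the CM / X12 situation: bad places `≠ p` additive, `p ≥ 5`).
  What `BSD_p(W)` still needs: the identification of `ord_p f(0)` with the analytic side —
  (C1_η) ∧ (C2_η-GZ), typed, not claimed; (C3_η) as typed is untouched.

References: [GreenbergLNM1716] §2, §3 Lemma 3.3, §4 Thm. 4.1, Lemma 4.2; [Kobayashi2003] Def. 2.1,
Thm. 6.2, Prop. 8.7, Lemma 9.1, Thm. 9.3; [MilneADT2006] I Thm. 2.8, Lemma 3.3, Thm. 4.10;
[SilvermanAEC2009] VII.6.3, VIII.§1.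
-/

noncomputable section

open scoped Classical

open CategoryTheory Field Function NumberField IsDedekindDomain WeierstrassCurve
open Literature.NumberTheory.EllipticCurves
open Literature.NumberTheory.GaloisRepresentations
open Literature.NumberTheory.GaloisRepresentations.DiscreteGaloisModule (SelmerStructure)
open Literature.NumberTheory.GaloisCohomology
open Literature.NumberTheory.EllipticCurves.Kobayashi2003
open Literature.NumberTheory.EllipticCurves.IwasawaAlgebra
open Literature.NumberTheory.EllipticCurves.IwasawaDual
open Summit.BirchSwinnertonDyer.Rank1Residual.X11b.Levels
open Summit.BirchSwinnertonDyer.Rank1Residual.X11b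
open Summit.BirchSwinnertonDyer.Rank1Residual.Additive.DefectCountFiniteLevel
open scoped ContRepresentation

-- Over `ℚ` two `ℚ`-algebra structures on a completion are in scope (`DivisionRing.toRatAlgebra` and the
-- completion's own); the tree's general-`K` statements (files 75/99/100/107: `Place.instAlgebraCompletion`,
-- which unfolds to the latter) must be met by the latter, so it is preferred locally (this file only;
-- the same device as files 78 and 107).
attribute [local instance 10000] IsDedekindDomain.HeightOneSpectrum.instAlgebraAdicCompletion
  NumberField.Place.instAlgebraCompletion

namespace Summit.BirchSwinnertonDyer.Rank1Residual.Additive.LevelBridge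

variable (W : WeierstrassCurve ℚ) [W.IsElliptic] {p : ℕ} [hp : Fact p.Prime] (κ : ZpExtension ℚ p)
  {m : ℕ} [hint : (W.baseChange ℚ_[p]).IsIntegral ℤ_[p]]

/-! ### §1 The Selmer side at a level `p^m` -/

/-- **THE SELMER SIDE OF THE (C3_η) DERIVATION AT LEVEL `p^m`:
`#Sel_str(W/ℚ)[p^∞] · (p^ν · ∏_{ℓ ∈ T} p^{ord_p c_ℓ(W)}) = p^{ord_p f(0)}`** for the
`(−1)^{p/2}p`-twist `W` of a globally minimal `V/ℚ` with good reduction at the odd prime `p` and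
`a_p(V) = 0` (`W`'s equation `p`-integral, `κ` the cyclotomic `ℤ_p`-extension with topological
generator `γ`, `D` a strict signed dual datum of `Sel^{−,str}(W/ℚ_∞)` at the model `ℚ_[p]` whose `X`
is f.g. `Λ`-torsion without finite submodules, `char(X) = (f)`, `f(0) ≠ 0`).  Files 59 (`#A₀ =
#S₀·[A₀:S₀] = p^{ord_p f(0)}`), 107 (the count (C): `[A₀ : S₀] = p^ν · ∏_ℓ [𝓣_ℓ : 𝓚_ℓ]`, the tower
structure supplied as an explicit term), 75 (`[𝓣_ℓ : 𝓚_ℓ] = p^{ord_p c_ℓ}`) and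
`#S₀ = #Sel_str(W/ℚ)[p^∞]` composed.  CONDITIONAL on exactly: the NAMED FACT
`poitouTate_selmerStructure_duality_real ℚ` (`hPT`); the dual datum; the exceptional finite set
`T ∌ v₀` of places `ℓ ∤ p` with `ord_p c_ℓ ≤ m` such that `𝒦_{v,0}[p^∞] = 0` off `T ∪ {v₀}`;
(MW) `P` generates `W(ℚ)/p^m` with order `p^m`; (Ш) `Ш[p^m] ⊆ Ш[p^e]`; the exact level
`ν` of `P` in `W(ℚ_{v₀})`; (kill) `p^{m−2ν−e}𝓚_ℓ = 0` (`ℓ ∈ T`); `ord_p f(0) + ν + e ≤ m`,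
`2ν + e ≤ m`, `1 ≤ m`.  Nothing about (C1_η), (C2_η-GZ), (C3_η) as typed, or `BSD(W, p)`, is
claimed; nothing booked. [cite: GreenbergLNM1716, §3 Lemma 3.3 (pp. 86–88), §4 Thm. 4.1 and Lemma 4.2 (p. 102)]
[cite: Kobayashi2003, Def. 2.1 (p. 5), Thm. 6.2 (p. 11), Lemma 9.1 (p. 25), Thm. 9.3 (p. 26)]
[cite: MilneADT2006, Ch. I, Thm. 2.8, Lemma 3.3 and Thm. 4.10] -/
theorem card_strictSelmerPInfty_mul_eq_pow_of_quadraticTwist_signedPrime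
    (hm : 1 ≤ m) (hp2 : p ≠ 2) (hκ : κ.IsCyclotomic) (Cv : VariableChange ℚ) (V : WeierstrassCurve ℚ)
    [V.IsElliptic] [V.IsGloballyMinimal] (hCV : Cv • W.quadraticTwist ((-1) ^ (p / 2) * p) = V)
    (hgood : V.HasGoodReductionAtPrime p) (hap : V.frobeniusTrace p = 0)
    -- the one fact-shaped input: Poitou–Tate duality with the real place
    (hPT : poitouTate_selmerStructure_duality_real ℚ)
    (v₀ : HeightOneSpectrum (𝓞 ℚ)) (hv₀ : (Rat.HeightOneSpectrum.primesEquiv (R := 𝓞 ℚ)).symm ⟨p, hp.out⟩ = v₀)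
    -- the strict signed dual datum of `Sel^{−,str}(W/ℚ_∞)` and its `Λ`-structure
    {γ : absoluteGaloisGroup ℚ} (hγ : κ.IsTopGenerator γ) (D : StrictSignedSelmerDualData W κ ℚ_[p] γ (-1))
    [Module.Finite (IwasawaAlgebra p) D.X] (hX : Module.IsTorsion (IwasawaAlgebra p) D.X)
    (hnf : ∀ N : Submodule (IwasawaAlgebra p) D.X, Finite N → N = ⊥)
    {f : IwasawaAlgebra p} (hf : D.charIdeal = Ideal.span {f}) (h0 : PowerSeries.constantCoeff f ≠ 0)
    -- the exceptional set
    (T : Finset (HeightOneSpectrum (𝓞 ℚ))) (hv₀T : v₀ ∉ T)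
    (hT0 : ∀ v : HeightOneSpectrum (𝓞 ℚ), v ∉ T →
      v ≠ v₀ → W.localTowerKerPrimary κ (v.adicCompletion ℚ) 0 = ⊥)
    (hpT : ∀ w ∈ T, (p : 𝓞 ℚ) ∉ w.asIdeal)
    (hcT : ∀ w ∈ T, padicValNat p ((W.baseChange (w.adicCompletion ℚ)).localTamagawaNumber
      (w.adicCompletionIntegers ℚ)) ≤ m)
    -- (MW)
    {ν eSha : ℕ} (P : W.toAffine.Point)
    (hgen : ∀ Q : W.toAffine.Point, ∃ a : ℤ,
      Q - a • P ∈ (zsmulAddGroupHom ((p ^ m : ℕ) : ℤ) : W.toAffine.Point →+ _).range)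
    (hord : ∀ a : ℤ, a • P ∈ (zsmulAddGroupHom ((p ^ m : ℕ) : ℤ) : W.toAffine.Point →+ _).range →
      ((p ^ m : ℕ) : ℤ) ∣ a)
    -- (Ш)
    (hSha : ∀ c ∈ W.sha, ((p ^ m : ℕ) : ℤ) • c = 0 → p ^ eSha • c = 0)
    -- (loc): the exact level `ν` of `P` at `v₀`
    {Qv : (W.baseChange (v₀.adicCompletion ℚ)).toAffine.Point}
    (hPQ : p ^ ν • Qv = Affine.Point.baseChange (W' := W) ℚ (v₀.adicCompletion ℚ) P)
    (hexact : ∀ Q' : (W.baseChange (v₀.adicCompletion ℚ)).toAffine.Point,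
      p ^ (ν + 1) • Q' ≠ Affine.Point.baseChange (W' := W) ℚ (v₀.adicCompletion ℚ) P)
    -- (kill) at `ℓ ∈ T`
    (hkill : ∀ w ∈ T, ∀ x ∈ W.kummerSelmerStructure ((p ^ m : ℕ) : ℤ) (Sum.inr w),
      p ^ (m - (ν + eSha) - ν) • x = 0)
    (hnum : (((PowerSeries.constantCoeff f : ℤ_[p]) : ℚ_[p]).valuation).toNat + ν + eSha ≤ m)
    (hm2 : 2 * ν + eSha ≤ m) :
    Nat.card ↥(strictSelmerPInfty W p) *
        (p ^ ν * ∏ w ∈ T, p ^ padicValNat p ((W.baseChange (w.adicCompletion ℚ)).localTamagawaNumber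
          (w.adicCompletionIntegers ℚ))) =
      p ^ (((PowerSeries.constantCoeff f : ℤ_[p]) : ℚ_[p]).valuation).toNat := by
  -- the tower structure `𝓣` on `W[p^m]`, as an explicit term
  let 𝓣 : SelmerStructure (W.torsionGaloisModule ((p ^ m : ℕ) : ℤ)) := fun v ↦
    match v with
    | Sum.inl w => W.kummerSelmerStructure ((p ^ m : ℕ) : ℤ) (Sum.inl w)
    | Sum.inr v => (W.localTowerKer κ (v.adicCompletion ℚ) 0).comap
        ((resH1Hom (Literature.NumberTheory.EllipticCurves.subgroupIncl
            (localSubgroup (κ.layerSubgroup 0) (v.adicCompletion ℚ)))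
          (AddMonoidHom.id (localPoints W (v.adicCompletion ℚ))) (fun _ _ ↦ rfl)).comp
          (galoisCohomology.map
            (W.torsionPointsMapIntertwining ((p ^ m : ℕ) : ℤ) (v.adicCompletion ℚ)) 1))
  have h𝓣fin : ∀ v : HeightOneSpectrum (𝓞 ℚ), 𝓣 (Sum.inr v) =
      (W.localTowerKer κ (v.adicCompletion ℚ) 0).comap
        ((resH1Hom (Literature.NumberTheory.EllipticCurves.subgroupIncl
            (localSubgroup (κ.layerSubgroup 0) (v.adicCompletion ℚ)))
          (AddMonoidHom.id (localPoints W (v.adicCompletion ℚ))) (fun _ _ ↦ rfl)).comp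
          (galoisCohomology.map
            (W.torsionPointsMapIntertwining ((p ^ m : ℕ) : ℤ) (v.adicCompletion ℚ)) 1)) := fun _ ↦ rfl
  have h𝓣inf : ∀ w : InfinitePlace ℚ, 𝓣 (Sum.inl w) = W.kummerSelmerStructure ((p ^ m : ℕ) : ℤ) (Sum.inl w) :=
    fun _ ↦ rfl
  -- B1 ⊕ B2 (file 59): `A₀` finite, `#A₀ = #S₀ · [A₀ : S₀]`, `#A₀ = p^{ord_p f(0)}`
  obtain ⟨hA₀fin, hmul, hA₀card⟩ :=
    StrictSignedControlZero.finite_localPreimage_and_natCard_eq_of_quadraticTwist_signedPrime κ W (-1)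
      hp2 Cv V hCV hgood hap hγ D hX hnf hf h0
  -- the count (C), file 107, with `a = ord_p f(0)`
  have hC := relIndex_strictSignedSelmerLayer_localPreimage_eq_of_quadraticTwist_signedPrime W κ hm hp2 hκ
    Cv V hCV hgood hap hPT v₀ hv₀ T hv₀T 𝓣 h𝓣fin h𝓣inf hT0 (dvd_of_eq hA₀card) P hgen hord hSha
    hPQ hexact hkill hnum hm2
  -- the local factors (file 75, B4)
  have hloc : ∀ w ∈ T, (W.kummerSelmerStructure ((p ^ m : ℕ) : ℤ) (Sum.inr w)).relIndex (𝓣 (Sum.inr w)) =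
      p ^ padicValNat p ((W.baseChange (w.adicCompletion ℚ)).localTamagawaNumber
        (w.adicCompletionIntegers ℚ)) := fun w hw ↦ by
    -- no finite place splits completely in the cyclotomic tower (file 54)
    obtain ⟨δ, hδ⟩ := Greenberg1999.exists_apply_resGal_ne_one_of_isCyclotomic hκ w
    exact relIndex_kummer_comap_localTowerKer_eq_pow_padicValNat_localTamagawaNumber W p κ m (hpT w hw)
      ⟨δ, fun h ↦ hδ (ZpExtension.mem_kerSubgroup.mp h)⟩ (hcT w hw)
  rw [Finset.prod_congr rfl hloc] at hC
  -- `#A₀ = #S₀ · [A₀ : S₀]`, `#S₀ = #Sel_str(W/ℚ)[p^∞]`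
  have hrel : Nat.card (↥((W.selmerInfty κ ⊓
        ⨅ σ : absoluteGaloisGroup ℚ,
          (localKummerOverOfEmb W p κ.kerSubgroup (closureEmb (K := ℚ) ℚ_[p])
              (⨆ n, strictSignedLocalPoints κ ℚ_[p] W (-1) n)).comap (W.conjH1 p κ.kerSubgroup σ)).comap
        (W.layerToInfty κ 0)) ⧸
      (strictSignedSelmerLayer W κ ℚ_[p] (-1) 0).addSubgroupOf ((W.selmerInfty κ ⊓
        ⨅ σ : absoluteGaloisGroup ℚ,
          (localKummerOverOfEmb W p κ.kerSubgroup (closureEmb (K := ℚ) ℚ_[p])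
              (⨆ n, strictSignedLocalPoints κ ℚ_[p] W (-1) n)).comap (W.conjH1 p κ.kerSubgroup σ)).comap
        (W.layerToInfty κ 0))) =
      (strictSignedSelmerLayer W κ ℚ_[p] (-1) 0).relIndex ((W.selmerInfty κ ⊓
        ⨅ σ : absoluteGaloisGroup ℚ,
          (localKummerOverOfEmb W p κ.kerSubgroup (closureEmb (K := ℚ) ℚ_[p])
              (⨆ n, strictSignedLocalPoints κ ℚ_[p] W (-1) n)).comap (W.conjH1 p κ.kerSubgroup σ)).comap
        (W.layerToInfty κ 0)) := rfl
  rw [hrel, hC, StrictSignedLayerZero.natCard_strictSignedSelmerLayer_neg_one_zero_eq_strictSelmerPInfty W κ]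
    at hmul
  rw [← hmul]
  exact hA₀card

/-! ### §2 Rank one, level-free -/

section RankOne

variable
    (hp2 : p ≠ 2) (Cv : VariableChange ℚ) (V : WeierstrassCurve ℚ)
    [V.IsElliptic] [V.IsGloballyMinimal] (hCV : Cv • W.quadraticTwist ((-1) ^ (p / 2) * p) = V)
    (hgood : V.HasGoodReductionAtPrime p) (hap : V.frobeniusTrace p = 0)
    {γ : absoluteGaloisGroup ℚ} (hγ : κ.IsTopGenerator γ) (D : StrictSignedSelmerDualData W κ ℚ_[p] γ (-1))
    [Module.Finite (IwasawaAlgebra p) D.X] (hX : Module.IsTorsion (IwasawaAlgebra p) D.X)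
    (hnf : ∀ N : Submodule (IwasawaAlgebra p) D.X, Finite N → N = ⊥)
    {f : IwasawaAlgebra p} (hf : D.charIdeal = Ideal.span {f}) (h0 : PowerSeries.constantCoeff f ≠ 0)
    (P : W.toAffine.Point) (hP : ¬ IsOfFinAddOrder P)
    (hgen : ∀ R : W.toAffine.Point, ∃ (k : ℤ) (T : W.toAffine.Point), IsOfFinAddOrder T ∧ R = k • P + T)
    {ν : ℕ}
    (hdiv : ∃ Q : (W.baseChange ℚ_[p]).toAffine.Point,
      p ^ ν • Q = Affine.Point.baseChange (W' := W) ℚ ℚ_[p] P)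
    (hndiv : ∀ Q : (W.baseChange ℚ_[p]).toAffine.Point,
      p ^ (ν + 1) • Q ≠ Affine.Point.baseChange (W' := W) ℚ ℚ_[p] P)

include hp2 hCV hgood hap hγ hX hnf hf h0 hP hgen hdiv hndiv

omit hint in
/-- **`Ш(W)[p^∞]` is FINITE** for the `p*`-twist in rank one, from the dual datum with `f(0) ≠ 0`:
`Sel_str(W/ℚ)[p^∞]` is finite (file 57, B1 ⊕ B2 for the twist) and `#Sel_str = p^ν · #Ш[p^∞]`
(gen 30, `StrictSha.strictSelmerIndexAt_holds`, for a generator modulo torsion of exact level `ν`;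
`W(ℚ_p)[p] = 0` by file 55), so `#Ш[p^∞] ≠ 0`.  CONDITIONAL on the dual datum; nothing booked.
[cite: Kobayashi2003, Thm. 9.3 (p. 26)] [cite: GreenbergLNM1716, §2 (pp. 62–63), §4 Thm. 4.1] -/
theorem finite_primaryComponent_sha_of_quadraticTwist_signedPrime :
    Finite (AddCommGroup.primaryComponent W.sha p) := by
  haveI hfin := (StrictSignedControlZero.finite_and_padicValNat_card_strictSelmerPInfty_add_eq_of_quadraticTwist_signedPrime
    W hp2 Cv V hCV hgood hap hγ D hX hnf hf h0).1
  obtain ⟨M₀, hΔ, hA, hVM₀⟩ := exists_goodSupersingularPadicModel hp2 V hgood hap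
  have htorsX := eq_zero_of_prime_smul_eq_zero_padic_of_quadraticTwist_signedPrime hp2 W Cv hCV M₀ hΔ hA hVM₀
  have hidx := StrictSha.strictSelmerIndexAt_holds W p P ν hP hgen htorsX hdiv hndiv
  refine Nat.finite_of_card_ne_zero fun hz ↦ ?_
  have hpos : 0 < Nat.card ↥(strictSelmerPInfty W p) := Nat.card_pos
  rw [hidx, hz, mul_zero] at hpos
  exact lt_irrefl 0 hpos

variable (hκ : κ.IsCyclotomic) (hPT : poitouTate_selmerStructure_duality_real ℚ)

include hκ hPT

/-- **THE SELMER SIDE OF THE (C3_η) DERIVATION IN RANK ONE, LEVEL-FREE: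
`#Sel_str(W/ℚ)[p^∞] · (p^ν · ∏_{ℓ ∈ T} p^{ord_p c_ℓ(W)}) = p^{ord_p f(0)}`** for the
`(−1)^{p/2}p`-twist `W` of a globally minimal `V/ℚ` with good reduction at the odd prime `p` and
`a_p(V) = 0` (`W`'s equation `p`-integral; `κ` the cyclotomic `ℤ_p`-extension with topological
generator `γ`; `D` a strict signed dual datum of `Sel^{−,str}(W/ℚ_∞)` at the model `ℚ_[p]`, `X` f.g.
`Λ`-torsion without finite submodules, `char(X) = (f)`, `f(0) ≠ 0`), given: a point `P ∈ W(ℚ)` of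
infinite order generating `W(ℚ)` modulo torsion; its exact level `ν` in `W(ℚ_p)` (`P ⊗ ℚ_p =
Affine.Point.baseChange ℚ ℚ_[p] P = W.toPadicPoint p P`; then `Ш(W)[p^∞]` is finite); `T ∌ (p)` a
finite set of places containing every `ℓ ≠ p` with `p ∣ c_ℓ(W)`.  File 108 at the level
`m = ord_p f(0) + 2ν + e + ∑ s_ℓ + ∑ ord_p c_ℓ + 1`, all of whose level-`m` hypotheses are supplied by
file 109.  CONDITIONAL on the NAMED FACT `poitouTate_selmerStructure_duality_real ℚ` (`hPT`) and the
dual datum; nothing about (C1_η), (C2_η-GZ), (C3_η) as typed, or `BSD(W, p)`, is claimed; nothing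
booked. [cite: GreenbergLNM1716, §3 Lemma 3.3 (pp. 86–88), §4 Thm. 4.1 and Lemma 4.2 (p. 102)]
[cite: Kobayashi2003, Def. 2.1 (p. 5), Thm. 6.2 (p. 11), Prop. 8.7 (p. 16), Thm. 9.3 (p. 26)]
[cite: MilneADT2006, Ch. I, Thm. 2.8, Lemma 3.3 and Thm. 4.10] [cite: SilvermanAEC2009, Prop. VII.6.3] -/
theorem card_strictSelmerPInfty_mul_eq_pow_of_quadraticTwist_signedPrime_rankOne
    -- the exceptional set: any finite set of places `≠ (p)` containing every `ℓ ≠ p` with `p ∣ c_ℓ`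
    (T : Finset (HeightOneSpectrum (𝓞 ℚ)))
    (hpT : (Rat.HeightOneSpectrum.primesEquiv (R := 𝓞 ℚ)).symm ⟨p, hp.out⟩ ∉ T)
    (hT : ∀ v : HeightOneSpectrum (𝓞 ℚ), v ≠ (Rat.HeightOneSpectrum.primesEquiv (R := 𝓞 ℚ)).symm ⟨p, hp.out⟩ →
      p ∣ (W.baseChange (v.adicCompletion ℚ)).localTamagawaNumber (v.adicCompletionIntegers ℚ) → v ∈ T) :
    Nat.card ↥(strictSelmerPInfty W p) *
        (p ^ ν * ∏ w ∈ T, p ^ padicValNat p ((W.baseChange (w.adicCompletion ℚ)).localTamagawaNumber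
          (w.adicCompletionIntegers ℚ))) =
      p ^ (((PowerSeries.constantCoeff f : ℤ_[p]) : ℚ_[p]).valuation).toNat := by
  set v₀ := (Rat.HeightOneSpectrum.primesEquiv (R := 𝓞 ℚ)).symm ⟨p, hp.out⟩ with hv₀def
  -- places: `p ∈ w ↔ w = v₀`
  have hpw : ∀ w : HeightOneSpectrum (𝓞 ℚ), w ≠ v₀ → (p : 𝓞 ℚ) ∉ w.asIdeal := fun w hw h ↦
    hw ((natCast_mem_asIdeal_iff_eq_primesEquiv_symm w hp.out).mp h)
  have hpT' : ∀ w ∈ T, (p : 𝓞 ℚ) ∉ w.asIdeal := fun w hw ↦ hpw w fun h ↦ hpT (h ▸ hw)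
  -- no `p`-torsion in `W(ℚ_p)` (file 55), hence in `W(ℚ)`
  obtain ⟨M₀, hΔ, hA, hVM₀⟩ := exists_goodSupersingularPadicModel hp2 V hgood hap
  have htorsX := eq_zero_of_prime_smul_eq_zero_padic_of_quadraticTwist_signedPrime hp2 W Cv hCV M₀ hΔ hA hVM₀
  have htorsQ : ∀ R : W.toAffine.Point, p • R = 0 → R = 0 := fun R hR ↦ by
    have h1 : Affine.Point.map (W' := W) (Algebra.ofId ℚ ℚ_[p]) (p • R) = 0 := by
      rw [hR]; exact map_zero _
    have h2 : p • Affine.Point.map (W' := W) (Algebra.ofId ℚ ℚ_[p]) R = 0 :=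
      (map_nsmul (Affine.Point.map (W' := W) (Algebra.ofId ℚ ℚ_[p])) p R).symm.trans h1
    exact Affine.Point.map_injective (W' := W) (f := Algebra.ofId ℚ ℚ_[p])
      ((htorsX _ h2).trans (map_zero _).symm)
  -- (kill): the bounds `s_w` (file 109 §1)
  have hkill0 : ∀ w : HeightOneSpectrum (𝓞 ℚ), ∃ s : ℕ, (p : 𝓞 ℚ) ∉ w.asIdeal →
      ∀ m k : ℕ, s ≤ k → ∀ x ∈ W.kummerSelmerStructure ((p ^ m : ℕ) : ℤ) (Sum.inr w), p ^ k • x = 0 := by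
    intro w
    by_cases h : (p : 𝓞 ℚ) ∈ w.asIdeal
    · exact ⟨0, fun h' ↦ absurd h h'⟩
    · obtain ⟨s, hs⟩ := exists_pow_smul_kummerSelmerStructure_inr_eq_zero W h
      exact ⟨s, fun _ ↦ hs⟩
  choose s hs using hkill0
  -- (Ш): `Ш(W)[p^∞]` is finite (below), whence the exponent `e` (file 109 §3)
  have hSha := finite_primaryComponent_sha_of_quadraticTwist_signedPrime W κ hp2 Cv V hCV hgood hap hγ D hX hnf hf
    h0 P hP hgen hdiv hndiv
  obtain ⟨e, he⟩ := exists_exponent_of_finite_primaryComponent W.sha hSha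
  -- the local Tamagawa exponents `c w = ord_p c_w(W)` (as an opaque function) and the level `m`
  -- (an opaque natural number with its defining equation)
  obtain ⟨c, hc⟩ : ∃ c : HeightOneSpectrum (𝓞 ℚ) → ℕ, ∀ w, c w =
      padicValNat p ((W.baseChange (w.adicCompletion ℚ)).localTamagawaNumber (w.adicCompletionIntegers ℚ)) :=
    ⟨_, fun _ ↦ rfl⟩
  have hcle : ∀ w ∈ T, c w ≤ ∑ w ∈ T, c w := fun w hw ↦
    Finset.single_le_sum (fun _ _ ↦ Nat.zero_le _) hw
  have hsle : ∀ w ∈ T, s w ≤ ∑ w ∈ T, s w := fun w hw ↦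
    Finset.single_le_sum (fun _ _ ↦ Nat.zero_le _) hw
  obtain ⟨m, hm⟩ : ∃ m : ℕ, m = (((PowerSeries.constantCoeff f : ℤ_[p]) : ℚ_[p]).valuation).toNat + 2 * ν + e +
      (∑ w ∈ T, s w) + (∑ w ∈ T, c w) + 1 := ⟨_, rfl⟩
  -- (MW) at level `m` (file 109 §2)
  obtain ⟨hgenm, hordm⟩ := rankOne_level_inputs (p := p) hP hgen htorsQ m
  -- (loc): the exact level, transported along `ℚ_[p] ≃ ℚ_{v₀}` (file 109 §4)
  obtain ⟨eq⟩ : Nonempty (ℚ_[p] ≃A[ℚ] v₀.adicCompletion ℚ) := ⟨Padic.adicCompletionEquiv (𝓞 ℚ) ⟨p, hp.out⟩⟩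
  obtain ⟨Qv, hPQ⟩ := exists_nsmul_eq_baseChange_of_algHom W ℚ_[p] (v₀.adicCompletion ℚ)
    (eq : ℚ_[p] →ₐ[ℚ] v₀.adicCompletion ℚ) P (p ^ ν) hdiv
  have hexact : ∀ Q' : (W.baseChange (v₀.adicCompletion ℚ)).toAffine.Point,
      p ^ (ν + 1) • Q' ≠ Affine.Point.baseChange (W' := W) ℚ (v₀.adicCompletion ℚ) P := fun Q' hQ' ↦ by
    obtain ⟨Q, hQ⟩ := exists_nsmul_eq_baseChange_of_algHom W (v₀.adicCompletion ℚ) ℚ_[p]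
      ((eq.symm : v₀.adicCompletion ℚ ≃A[ℚ] ℚ_[p]) : v₀.adicCompletion ℚ →ₐ[ℚ] ℚ_[p]) P (p ^ (ν + 1))
      ⟨Q', hQ'⟩
    exact hndiv Q hQ
  -- file 108 at the level `m`
  exact card_strictSelmerPInfty_mul_eq_pow_of_quadraticTwist_signedPrime W κ (m := m) (by omega) hp2 hκ Cv V
    hCV hgood hap hPT v₀ rfl hγ D hX hnf hf h0 T hpT
    (fun v hv hne ↦ localTowerKerPrimary_eq_bot_of_not_dvd_localTamagawaNumber W hκ (hpw v hne)
      fun hd ↦ hv (hT v hne hd))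
    hpT' (fun w hw ↦ (hc w) ▸ (hcle w hw).trans (by omega)) P hgenm hordm (fun x hx hmx ↦ he x hx m hmx) hPQ
    hexact
    (fun w hw x hx ↦ hs w (hpT' w hw) m _ ((hsle w hw).trans (by omega)) x hx) (by omega) (by omega)

/-- **THE ALGEBRAIC SIDE OF `BSD_p` FOR THE `p*`-TWIST IN RANK ONE, THROUGH `f(0)`:
`#Ш(W)[p^∞] · (p^{2ν} · ∏_{ℓ ∈ T} p^{ord_p c_ℓ(W)}) = p^{ord_p f(0)}`** — the previous theorem composed
with gen 30's `StrictSha.strictSelmerIndexAt_holds` (`#Sel_str(W/ℚ)[p^∞] = p^ν · #Ш(W)[p^∞]` for a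
rank-one generator of exact level `ν`, `W(ℚ_p)[p] = 0` being file 55's theorem for the twist).  Same
hypotheses, same CONDITIONALITY (`hPT`, the dual datum, the rank-one inputs);
nothing about (C1_η), (C2_η-GZ), (C3_η) as typed, or `BSD(W, p)`, is claimed; nothing booked.
[cite: GreenbergLNM1716, §2 (pp. 62–63), §4 Thm. 4.1] [cite: Kobayashi2003, Thm. 9.3 (p. 26)]
[cite: MilneADT2006, Ch. I, Thm. 4.10] -/
theorem card_sha_mul_eq_pow_of_quadraticTwist_signedPrime_rankOne
    (T : Finset (HeightOneSpectrum (𝓞 ℚ)))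
    (hpT : (Rat.HeightOneSpectrum.primesEquiv (R := 𝓞 ℚ)).symm ⟨p, hp.out⟩ ∉ T)
    (hT : ∀ v : HeightOneSpectrum (𝓞 ℚ), v ≠ (Rat.HeightOneSpectrum.primesEquiv (R := 𝓞 ℚ)).symm ⟨p, hp.out⟩ →
      p ∣ (W.baseChange (v.adicCompletion ℚ)).localTamagawaNumber (v.adicCompletionIntegers ℚ) → v ∈ T) :
    Nat.card (AddCommGroup.primaryComponent W.sha p) *
        (p ^ (2 * ν) * ∏ w ∈ T, p ^ padicValNat p ((W.baseChange (w.adicCompletion ℚ)).localTamagawaNumber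
          (w.adicCompletionIntegers ℚ))) =
      p ^ (((PowerSeries.constantCoeff f : ℤ_[p]) : ℚ_[p]).valuation).toNat := by
  have h := card_strictSelmerPInfty_mul_eq_pow_of_quadraticTwist_signedPrime_rankOne W κ hp2 Cv V hCV hgood hap hγ
    D hX hnf hf h0 P hP hgen hdiv hndiv hκ hPT T hpT hT
  obtain ⟨M₀, hΔ, hA, hVM₀⟩ := exists_goodSupersingularPadicModel hp2 V hgood hap
  have htorsX := eq_zero_of_prime_smul_eq_zero_padic_of_quadraticTwist_signedPrime hp2 W Cv hCV M₀ hΔ hA hVM₀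
  rw [StrictSha.strictSelmerIndexAt_holds W p P ν hP hgen htorsX hdiv hndiv] at h
  rw [← h]
  ring

/-- **`#Ш(W)[p^∞] · p^{2ν} = p^{ord_p f(0)}` when `p ∤ c_ℓ(W)` for every place `ℓ ≠ p`** — the case
`T = ∅` of the previous theorem (e.g. every bad place of `W` other than `p` additive and `p ≥ 5`, the
CM / X12 situation of class O10).  Same CONDITIONALITY (`hPT`, the dual datum, the rank-one inputs); nothing about (C1_η), (C2_η-GZ), (C3_η) as typed, or `BSD(W, p)`, is claimed;
nothing booked. [cite: GreenbergLNM1716, §4 Thm. 4.1] [cite: Kobayashi2003, Thm. 9.3 (p. 26)] -/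
theorem card_sha_mul_pow_eq_pow_of_quadraticTwist_signedPrime_rankOne_of_not_dvd
    (hTam : ∀ v : HeightOneSpectrum (𝓞 ℚ), v ≠ (Rat.HeightOneSpectrum.primesEquiv (R := 𝓞 ℚ)).symm ⟨p, hp.out⟩ →
      ¬ p ∣ (W.baseChange (v.adicCompletion ℚ)).localTamagawaNumber (v.adicCompletionIntegers ℚ)) :
    Nat.card (AddCommGroup.primaryComponent W.sha p) * p ^ (2 * ν) =
      p ^ (((PowerSeries.constantCoeff f : ℤ_[p]) : ℚ_[p]).valuation).toNat := by
  have h := card_sha_mul_eq_pow_of_quadraticTwist_signedPrime_rankOne W κ hp2 Cv V hCV hgood hap hγ D hX hnf hf h0 P hP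
    hgen hdiv hndiv hκ hPT ∅ (by simp) (fun v hv hd ↦ absurd hd (hTam v hv))
  rwa [Finset.prod_empty, mul_one] at h

end RankOne

end Summit.BirchSwinnertonDyer.Rank1Residual.Additive.LevelBridge

end
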